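import Summits.BirchSwinnertonDyer.BirchSwinnertonDyer.Theorems.PrintX11aLowerHalfOfChildrenFourPartner
import Summits.BirchSwinnertonDyer.BirchSwinnertonDyer.Theorems.PrintX11aLowerHalfTresRamifieCore
import HarnessLib

/-!
# Crux `X11aLowerHalf` (item stmt-BirchSwinnertonDyer-19064; routes `PrintX11a` rank 2 ∕ `ErratumRoadFive` rank 5) and the leaf
# `WAllCornerX11a` from the children of line «birth» r12 — the très-ramifié open core at `p = 3` in MAIN-CONJECTURE currency
# (lead bsd-line-x11a-p1 gen 4; `--supports stmt-BirchSwinnertonDyer-19064` helper)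

HONEST FRAMING.  Five composition theorems; no definition, no named fact minted, no `sorry`.  Every theorem is CONDITIONAL and
closes NOTHING: each hypothesis is DISPLAYED — twenty-five statement-only named published facts (never proved; Skinner–Urban 3.6.4
(ram) rational carries the cell's counting flag `SU14-12.3.6-mu@nonsplit@3`; the Emerton–Pollack–Weston odd-prime instances and
Yan–Zhu Thm. 4.9 carry the disclosure tokens `EPW06@3-Hida-control` ∕ `YZ26@3-BF-ERL-Ohta`), K2's OPEN item 19948 and TWO OPEN
research statements: Greenberg's analytic `μ = 0` (Conj. 1.11, ω⁰ branch) on the deep SURJECTIVE X11a pairs at `p ≥ 5` (`hS`) and the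
RATIONAL cyclotomic main-conjecture equality at `p = 3` for some `3`-ordinary member of `H(E[3])` at every très-ramifié off-Kodaira deep
X11a pair (`hM` — X. Wan's Thm. 4 conclusion at `p = 3`; Wan 2015 prints `p ⩾ 5`, Skinner–Urban 3.6.4 needs a (ram) prime: NOT IN PRINT).
The gate records a `conditional-result`; the leaf `WAllCornerX11a` is an OPEN `@[conjecture]` and is NOT proved; BSD is proved for no curve
and no class; PARTITION 0.  beyond-print theorem: no.  No summit statement is proved by this seat.

## What and why

Line «birth» r12 (`Cruxes/X11aLowerHalf/Lines/birth.lean`, lead gen 4) registers SEVEN stubs; compared with r11 (children glue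
`Birth.x11aLowerHalf_of_children_r11`, width seat er5-p2 gen 7, `Theorems/PrintX11aLowerHalfOfChildrenFourPartner.lean`) the seventh child
changed currency: r7–r11's `stub_lowerTresRamifieThree` (the lower half `Typed.MissingLowerBoundAt W 3` on the très-ramifié off-Kodaira deep
X11a locus) is now a THEOREM of the skeleton, derived from the NEW registered stub `stub_memberRatEqAtTresRamifieThree` — the binder `hmem`
of er5-p2's landed door `OddChain.tresRamifieThree_of_forall_memberRatEqAt_of_twelveFacts` VERBATIM (`Theorems/PrintX11aLowerHalfTresRamifieCore.lean`,
REF V73 ∕ V74): «at every such pair SOME `3`-ordinary member `g ∈ S_k(Γ₀(M))`, `3 ∤ M`, of `H(E[3])` (`OddChain.IsOrdinaryMemberOfLevel`)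
satisfies `OddChain.RatEqAtMember 3 g ι` — `char_Λ X(ℚ_∞, A_g) = (L_3(g))` in `Λ_𝒪 ⊗ ℚ_3`».  This file is the r12 CHILDREN GLUE:

* `Birth.lowerTresRamifieThree_of_memberRatEqAt_of_nineFactsOddGS_of_elevenFacts` — the r7–r11 child text (lower half on the locus) from
  the shared nine-fact child `h9`, the eleven-fact child `h11` and the member child `hM`: er5-p2's PER-PAIR door
  `ClassX11a.missingLowerBoundAt_three_of_tresRamifie_of_memberRatEqAt_of_facts` fed by twelve of the twenty facts (Greenberg–Stevens
  AT THE PAIR — `3 ≠ 2`, so the ODD-keyed display of the nine suffices, cf. REF V73 (d)) and Wuthrich's Lemma 20 FROM THE TREE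
  (`Wuthrich2014.lemma20_surjective_threeAdic_of_semistable_holds`).
* `Birth.x11aLowerHalf_of_children_r12` (+ the `ErratumRoadFive` spelling) — crux L BY NAME from the seven r12 children
  := `x11aLowerHalf_of_children_r11` with its seventh slot fed by the previous theorem.
* `PrintX11aLeaf.cruxes_of_children_r12`, `PrintX11aLeaf.wAllCornerX11a_of_children_r12` — the leaf twins, likewise.

PLANNER TURNKEY (W-81′; children = the seven r12 registered stub texts VERBATIM; 19948 exists):
`theorem X11aLowerHalf_holds : Theses.PrintX11a.X11aLowerHalf := Birth.x11aLowerHalf_of_children_r12 C_nine C_eleven C_ram C_facts4 C_19948 C_surj C_member`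
(`--workitem stmt-BirchSwinnertonDyer-19064`).  Nothing here is new mathematics.

References: [Wan2015] Thm. 4 (pp. 4–5: "Suppose that p ⩾ 5") = Thm. 103 (pp. 91–92); [SkinnerUrban2014] Thm. 3.6.4 (p. 43), Prop. 12.3.6;
[EmertonPollackWeston2006] Intro p. 2 (H(ρ̄)), Thm. 1, Thm. 3.1.1, Thm. 5.1.3, Cor. 5.1.4; [Wuthrich2014] Thm. 3, Lemma 20 (p. 399), Prop. 21;
[Mazur1978] Cor. 4.1; [Kato2004Asterisque] Thm. 12.4, §17.13; [SteinWuthrich2013] Thm. 6.1; [GreenbergLNM1716] Conj. 1.11; [Miller2011LMS] Def. 1.1;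
cell files `Cruxes/X11aLowerHalf/Lines/birth.lean` (r12), `TR-CORE-DOORS-g6.md` (er5-p2 g6: doors shut at 3, barrier candidate «B-3±1»).
-/

set_option autoImplicit false
set_option linter.dupNamespace false -- the directory name repeats the summit name (sibling precedent)

noncomputable section

open scoped Classical

open WeierstrassCurve IsDedekindDomain Rat.HeightOneSpectrum
  Literature.NumberTheory.EllipticCurves
  Literature.NumberTheory.EllipticCurves.ModularForms
  Literature.NumberTheory.EllipticCurves.Rank1Residual
  Literature.NumberTheory.EllipticCurves.Rank1Residual.Typed
  Literature.NumberTheory.EllipticCurves.Wuthrich2014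
  Literature.NumberTheory.EllipticCurves.SteinWuthrich2013
  Literature.NumberTheory.EllipticCurves.Greenberg1999
  Literature.NumberTheory.EllipticCurves.Kato2004
  Literature.NumberTheory.EllipticCurves.GreenbergVatsal2000
  Literature.NumberTheory.EllipticCurves.EmertonPollackWeston2006
  Literature.NumberTheory.EllipticCurves.SkinnerUrban2014
  Literature.NumberTheory.EllipticCurves.BalakrishnanEtAl2019
  Summit.BirchSwinnertonDyer.Rank1Residual
  Summit.BirchSwinnertonDyer.BirchSwinnertonDyer.Theorems.OddChain

namespace Summit.BirchSwinnertonDyer.BirchSwinnertonDyer.Theorems.Birth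

/-- **The r7–r11 child `stub_lowerTresRamifieThree` (the lower half on the très-ramifié off-Kodaira deep X11a locus at `3`) from the
shared nine-fact child, the eleven-fact child and the r12 MEMBER child** `hM` («some `3`-ordinary member of `H(E[3])` has the rational
cyclotomic main-conjecture equality at `3`», X. Wan's Thm. 4 shape at `p = 3` — NOT in print): er5-p2's per-pair door
`ClassX11a.missingLowerBoundAt_three_of_tresRamifie_of_memberRatEqAt_of_facts` with modularity, Stein–Wuthrich 6.1 ×2, Greenberg–Stevens
at the pair (`3 ≠ 2`) and Mazur Cor. 4.1 from `h9`, EPW 3.1.1 ∕ Thm. 1 alg ∕ 5.1.3, Deligne–Serre 6.1, Hida 3.26, Kato–Wuthrich A32 and GZK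
from `h11`, Wuthrich's Lemma 20 from the tree.  CONDITIONAL; closes nothing; BSD is not proved.
[cite: Wan2015, Thm. 4 (pp. 4–5: "Suppose that p ⩾ 5")] [cite: Wuthrich2014, Lemma 20 (p. 399), Thm. 3 (p. 382)]
[cite: EmertonPollackWeston2006, Thm. 1, Thm. 3.1.1, Thm. 5.1.3] [cite: Mazur1978, Cor. 4.1] [cite: Miller2011LMS, Def. 1.1] -/
theorem lowerTresRamifieThree_of_memberRatEqAt_of_nineFactsOddGS_of_elevenFacts
    (h9 : thm61_splitMultiplicative ∧ thm61_nonsplitMultiplicative ∧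
      (∀ (W : WeierstrassCurve ℚ) [W.IsElliptic] [W.IsGloballyMinimal] (p : ℕ) [Fact p.Prime],
        p ≠ 2 → greenberg_stevens (W := W) (p := p)) ∧
      Kato2004.thm12_4 ∧ exists_isNewformOf ∧
      Kato2004.exists_multDivisibilityInputs_nonsplit_contra ∧
      Kato2004.exists_multDivisibilityInputs_split_contra ∧
      Kato2004.exists_multDivisibilityInputs_fine_contra ∧ mazur_not_dvd_maninConstant_of_odd)
    (h11 : thm311_cotorsion_weightK_member_ofLevel_odd ∧ thm1_muAlg_of_weightK_member_ofLevel_odd ∧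
      Wan2015.thm4_rational_weightK_member_of_bdd_ofLevel_irred ∧
      thm513_transfer_from_weightK_member_of_bdd_ofLevel_odd ∧
      DeligneSerre1974.thm61_exists_adicGaloisRep ∧ Hida2000_thm326_ordinary ∧
      kato_charIdeal_dvd_multiplicative_of_surjective ∧
      rank_eq_analyticRank_of_analyticRank_le_one ∧
      thm12_not_le_normalizer_splitCartan ∧
      ribet1990_levelLowering_gamma0_newform_at_three_additiveDrop ∧
      carayolLivne_additivePrime_dvd_level_of_congruent_newform)
    (hM : ∀ (W : WeierstrassCurve ℚ) [W.IsElliptic] [W.IsGloballyMinimal] (p : ℕ) [Fact p.Prime],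
      ClassX11a W p → p = 3 → ¬ X11a.ShaAnUnit W p →
      ¬ (Surj W p ∧ ∃ v : HeightOneSpectrum ℤ, W.HasAdditiveReductionAt v ∧
          3 ∣ (W.kodairaSymbolAt v).componentGroupOrder ∧ ¬ natGenerator v ^ 3 ∣ W.conductorNorm ℤ) →
      ¬ p ∣ padicValInt p W.minimalDiscriminantInt → MemberRatEqAt W p) :
    ∀ (W : WeierstrassCurve ℚ) [W.IsElliptic] [W.IsGloballyMinimal] (p : ℕ) [Fact p.Prime],
      ClassX11a W p → p = 3 → ¬ X11a.ShaAnUnit W p →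
      ¬ (Surj W p ∧ ∃ v : HeightOneSpectrum ℤ, W.HasAdditiveReductionAt v ∧
          3 ∣ (W.kodairaSymbolAt v).componentGroupOrder ∧ ¬ natGenerator v ^ 3 ∣ W.conductorNorm ℤ) →
      ¬ p ∣ padicValInt p W.minimalDiscriminantInt → MissingLowerBoundAt W p := by
  obtain ⟨hJs, hJn, hGS, -, hNf, -, -, -, hMz⟩ := h9
  obtain ⟨h311, hT1a, -, hT1b, h61, h326, hKato, hGZK, -, -, -⟩ := h11
  intro W _ _ p _ hX hp3 hu hK hΔ
  have hp2 : p ≠ 2 := by omega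
  exact hX.missingLowerBoundAt_three_of_tresRamifie_of_memberRatEqAt_of_facts hNf h311 hT1a hT1b h61 h326 hKato
    Wuthrich2014.lemma20_surjective_threeAdic_of_semistable_holds hJs hJn hGZK (hGS W p hp2) hMz hp3 hΔ
    (hM W p hX hp3 hu hK hΔ)

/-- **Crux L `Theses.PrintX11a.X11aLowerHalf` BY NAME from the SEVEN children of line «birth» r12** — the shared nine (`h9`, = U3's ∕ U5's
nine-fact child), the eleven (`h11`), Skinner–Urban 3.6.4 (ram) rational (`hR`, flag SU14-12.3.6@3), the FOUR partner facts (`hQ4`), item 19948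
(`h48`), Greenberg Conj. 1.11 ω⁰ on the deep surjective X11a pairs at `p ≥ 5` (`hS`, OPEN) and the rational main-conjecture equality at `3` for
a member of `H(E[3])` on the très-ramifié off-Kodaira deep locus (`hM`, OPEN): er5-p2's `x11aLowerHalf_of_children_r11` with its seventh slot fed
by `lowerTresRamifieThree_of_memberRatEqAt_of_nineFactsOddGS_of_elevenFacts`.  CONDITIONAL; closes nothing by itself; BSD is not proved.
[cite: GreenbergLNM1716, §1 Conj. 1.11 (p. 61)] [cite: Wan2015, Thm. 4 (pp. 4–5)] [cite: SkinnerUrban2014, Thm. 3.6.4 (p. 43)]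
[cite: EmertonPollackWeston2006, Thm. 1, Cor. 5.1.4] [cite: Mazur1978, Cor. 4.1] [cite: Miller2011LMS, Def. 1.1] -/
theorem x11aLowerHalf_of_children_r12
    (h9 : thm61_splitMultiplicative ∧ thm61_nonsplitMultiplicative ∧
      (∀ (W : WeierstrassCurve ℚ) [W.IsElliptic] [W.IsGloballyMinimal] (p : ℕ) [Fact p.Prime],
        p ≠ 2 → greenberg_stevens (W := W) (p := p)) ∧
      Kato2004.thm12_4 ∧ exists_isNewformOf ∧
      Kato2004.exists_multDivisibilityInputs_nonsplit_contra ∧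
      Kato2004.exists_multDivisibilityInputs_split_contra ∧
      Kato2004.exists_multDivisibilityInputs_fine_contra ∧ mazur_not_dvd_maninConstant_of_odd)
    (h11 : thm311_cotorsion_weightK_member_ofLevel_odd ∧ thm1_muAlg_of_weightK_member_ofLevel_odd ∧
      Wan2015.thm4_rational_weightK_member_of_bdd_ofLevel_irred ∧
      thm513_transfer_from_weightK_member_of_bdd_ofLevel_odd ∧
      DeligneSerre1974.thm61_exists_adicGaloisRep ∧ Hida2000_thm326_ordinary ∧
      kato_charIdeal_dvd_multiplicative_of_surjective ∧
      rank_eq_analyticRank_of_analyticRank_le_one ∧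
      thm12_not_le_normalizer_splitCartan ∧
      ribet1990_levelLowering_gamma0_newform_at_three_additiveDrop ∧
      carayolLivne_additivePrime_dvd_level_of_congruent_newform)
    (hR : thm364_rational_weightK_member_of_bdd_ofLevel_ram)
    (hQ4 : cor514_transfer_of_goodOrdinary_odd ∧ YanZhu2026.thm49_charIdeal_eq_padicLFunction ∧
      thm1_muAlg_transfer_goodOrdinary_of_mult_odd ∧ thm1_muAn_transfer_goodOrdinary_of_mult_odd)
    (h48 : Summit.BirchSwinnertonDyer.BirchSwinnertonDyer.Theses.ErratumRoadFive.NonSurjCornerTwinMuAn)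
    (hS : ∀ (W : WeierstrassCurve ℚ) [W.IsElliptic] [W.IsGloballyMinimal] (p : ℕ) [Fact p.Prime],
      ClassX11a W p → 5 ≤ p → Surj W p → ¬ X11a.ShaAnUnit W p → X11a.MuAnZeroAt W p)
    (hM : ∀ (W : WeierstrassCurve ℚ) [W.IsElliptic] [W.IsGloballyMinimal] (p : ℕ) [Fact p.Prime],
      ClassX11a W p → p = 3 → ¬ X11a.ShaAnUnit W p →
      ¬ (Surj W p ∧ ∃ v : HeightOneSpectrum ℤ, W.HasAdditiveReductionAt v ∧
          3 ∣ (W.kodairaSymbolAt v).componentGroupOrder ∧ ¬ natGenerator v ^ 3 ∣ W.conductorNorm ℤ) →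
      ¬ p ∣ padicValInt p W.minimalDiscriminantInt → MemberRatEqAt W p) :
    Summit.BirchSwinnertonDyer.BirchSwinnertonDyer.Theses.PrintX11a.X11aLowerHalf :=
  x11aLowerHalf_of_children_r11 h9 h11 hR hQ4 h48 hS
    (lowerTresRamifieThree_of_memberRatEqAt_of_nineFactsOddGS_of_elevenFacts h9 h11 hM)

/-- The same composition concluding bsd-stepL's spelling `Theses.ErratumRoadFive.X11aLowerHalf` of the shared crux BY NAME (the two
route decls are one statement, `Iff.rfl`).  CONDITIONAL; closes nothing; BSD is not proved. [cite: Miller2011LMS, Def. 1.1 (arXiv:1010.2431 p. 3)] -/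
theorem x11aLowerHalf_erratumRoadFive_of_children_r12
    (h9 : thm61_splitMultiplicative ∧ thm61_nonsplitMultiplicative ∧
      (∀ (W : WeierstrassCurve ℚ) [W.IsElliptic] [W.IsGloballyMinimal] (p : ℕ) [Fact p.Prime],
        p ≠ 2 → greenberg_stevens (W := W) (p := p)) ∧
      Kato2004.thm12_4 ∧ exists_isNewformOf ∧
      Kato2004.exists_multDivisibilityInputs_nonsplit_contra ∧
      Kato2004.exists_multDivisibilityInputs_split_contra ∧
      Kato2004.exists_multDivisibilityInputs_fine_contra ∧ mazur_not_dvd_maninConstant_of_odd)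
    (h11 : thm311_cotorsion_weightK_member_ofLevel_odd ∧ thm1_muAlg_of_weightK_member_ofLevel_odd ∧
      Wan2015.thm4_rational_weightK_member_of_bdd_ofLevel_irred ∧
      thm513_transfer_from_weightK_member_of_bdd_ofLevel_odd ∧
      DeligneSerre1974.thm61_exists_adicGaloisRep ∧ Hida2000_thm326_ordinary ∧
      kato_charIdeal_dvd_multiplicative_of_surjective ∧
      rank_eq_analyticRank_of_analyticRank_le_one ∧
      thm12_not_le_normalizer_splitCartan ∧
      ribet1990_levelLowering_gamma0_newform_at_three_additiveDrop ∧
      carayolLivne_additivePrime_dvd_level_of_congruent_newform)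
    (hR : thm364_rational_weightK_member_of_bdd_ofLevel_ram)
    (hQ4 : cor514_transfer_of_goodOrdinary_odd ∧ YanZhu2026.thm49_charIdeal_eq_padicLFunction ∧
      thm1_muAlg_transfer_goodOrdinary_of_mult_odd ∧ thm1_muAn_transfer_goodOrdinary_of_mult_odd)
    (h48 : Summit.BirchSwinnertonDyer.BirchSwinnertonDyer.Theses.ErratumRoadFive.NonSurjCornerTwinMuAn)
    (hS : ∀ (W : WeierstrassCurve ℚ) [W.IsElliptic] [W.IsGloballyMinimal] (p : ℕ) [Fact p.Prime],
      ClassX11a W p → 5 ≤ p → Surj W p → ¬ X11a.ShaAnUnit W p → X11a.MuAnZeroAt W p)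
    (hM : ∀ (W : WeierstrassCurve ℚ) [W.IsElliptic] [W.IsGloballyMinimal] (p : ℕ) [Fact p.Prime],
      ClassX11a W p → p = 3 → ¬ X11a.ShaAnUnit W p →
      ¬ (Surj W p ∧ ∃ v : HeightOneSpectrum ℤ, W.HasAdditiveReductionAt v ∧
          3 ∣ (W.kodairaSymbolAt v).componentGroupOrder ∧ ¬ natGenerator v ^ 3 ∣ W.conductorNorm ℤ) →
      ¬ p ∣ padicValInt p W.minimalDiscriminantInt → MemberRatEqAt W p) :
    Summit.BirchSwinnertonDyer.BirchSwinnertonDyer.Theses.ErratumRoadFive.X11aLowerHalf :=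
  x11aLowerHalf_of_children_r12 h9 h11 hR hQ4 h48 hS hM

end Summit.BirchSwinnertonDyer.BirchSwinnertonDyer.Theorems.Birth

namespace Summit.BirchSwinnertonDyer.BirchSwinnertonDyer.Theorems.PrintX11aLeaf

/-- **Route `PrintX11a`'s three open cruxes — L (19064), U3 (20613), U5 (20614) — and the parent 20406, BY NAME, from the seven
children of line «birth» r12** (= er5-p2's `cruxes_of_children_r11`, p638322, with the seventh child in main-conjecture currency).
CONDITIONAL; closes nothing; BSD is proved for no curve.
[cite: GreenbergLNM1716, §1 Conj. 1.11 (p. 61)] [cite: Wan2015, Thm. 4 (pp. 4–5)] [cite: Kato2004Asterisque, Thm. 12.4 (p. 221), §17.13 (pp. 279–280)]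
[cite: SteinWuthrich2013, Thm. 6.1 (p. 20)] [cite: BalakrishnanEtAl2019, §1 Thm. 1.2] [cite: Mazur1978, Cor. 4.1] -/
theorem cruxes_of_children_r12
    (h9 : thm61_splitMultiplicative ∧ thm61_nonsplitMultiplicative ∧
      (∀ (W : WeierstrassCurve ℚ) [W.IsElliptic] [W.IsGloballyMinimal] (p : ℕ) [Fact p.Prime],
        p ≠ 2 → greenberg_stevens (W := W) (p := p)) ∧
      Kato2004.thm12_4 ∧ exists_isNewformOf ∧
      Kato2004.exists_multDivisibilityInputs_nonsplit_contra ∧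
      Kato2004.exists_multDivisibilityInputs_split_contra ∧
      Kato2004.exists_multDivisibilityInputs_fine_contra ∧ mazur_not_dvd_maninConstant_of_odd)
    (h11 : thm311_cotorsion_weightK_member_ofLevel_odd ∧ thm1_muAlg_of_weightK_member_ofLevel_odd ∧
      Wan2015.thm4_rational_weightK_member_of_bdd_ofLevel_irred ∧
      thm513_transfer_from_weightK_member_of_bdd_ofLevel_odd ∧
      DeligneSerre1974.thm61_exists_adicGaloisRep ∧ Hida2000_thm326_ordinary ∧
      kato_charIdeal_dvd_multiplicative_of_surjective ∧
      rank_eq_analyticRank_of_analyticRank_le_one ∧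
      thm12_not_le_normalizer_splitCartan ∧
      ribet1990_levelLowering_gamma0_newform_at_three_additiveDrop ∧
      carayolLivne_additivePrime_dvd_level_of_congruent_newform)
    (hR : thm364_rational_weightK_member_of_bdd_ofLevel_ram)
    (hQ4 : cor514_transfer_of_goodOrdinary_odd ∧ YanZhu2026.thm49_charIdeal_eq_padicLFunction ∧
      thm1_muAlg_transfer_goodOrdinary_of_mult_odd ∧ thm1_muAn_transfer_goodOrdinary_of_mult_odd)
    (h48 : Summit.BirchSwinnertonDyer.BirchSwinnertonDyer.Theses.ErratumRoadFive.NonSurjCornerTwinMuAn)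
    (hS : ∀ (W : WeierstrassCurve ℚ) [W.IsElliptic] [W.IsGloballyMinimal] (p : ℕ) [Fact p.Prime],
      ClassX11a W p → 5 ≤ p → Surj W p → ¬ X11a.ShaAnUnit W p → X11a.MuAnZeroAt W p)
    (hM : ∀ (W : WeierstrassCurve ℚ) [W.IsElliptic] [W.IsGloballyMinimal] (p : ℕ) [Fact p.Prime],
      ClassX11a W p → p = 3 → ¬ X11a.ShaAnUnit W p →
      ¬ (Surj W p ∧ ∃ v : HeightOneSpectrum ℤ, W.HasAdditiveReductionAt v ∧
          3 ∣ (W.kodairaSymbolAt v).componentGroupOrder ∧ ¬ natGenerator v ^ 3 ∣ W.conductorNorm ℤ) →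
      ¬ p ∣ padicValInt p W.minimalDiscriminantInt → MemberRatEqAt W p) :
    Summit.BirchSwinnertonDyer.BirchSwinnertonDyer.Theses.PrintX11a.X11aLowerHalf ∧
      Summit.BirchSwinnertonDyer.BirchSwinnertonDyer.Theses.PrintX11a.UpperNonSurjThree ∧
      Summit.BirchSwinnertonDyer.BirchSwinnertonDyer.Theses.PrintX11a.UpperNonSurjFive ∧
      Summit.BirchSwinnertonDyer.BirchSwinnertonDyer.Theses.PrintX11a.X11aNonSurjEulerHalf :=
  cruxes_of_children_r11 h9 h11 hR hQ4 h48 hS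
    (Birth.lowerTresRamifieThree_of_memberRatEqAt_of_nineFactsOddGS_of_elevenFacts h9 h11 hM)

/-- **The registered leaf `WAllCornerX11a` (rung W-ALL ∕ 11) DISPLAYED modulo the seven children of line «birth» r12 and Wuthrich
2014 Prop. 21** (= er5-p2's `wAllCornerX11a_of_children_r11`, p638322, with the seventh child in main-conjecture currency): in the kernel the
class theorem of leaf X11a holds MODULO twenty-six named published facts (one flagged SU14-12.3.6@3, the EPW ∕ Yan–Zhu instances with @3
tokens), K2's item 19948 and two OPEN named research statements (`hS`: Greenberg Conj. 1.11 ω⁰ on the deep surjective X11a pairs at `p ≥ 5`;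
`hM`: the rational cyclotomic main conjecture at `3` for a `3`-ordinary member of `H(E[3])` on the très-ramifié off-Kodaira deep X11a pairs).
CONDITIONAL: the conclusion is an OPEN `@[conjecture]` leaf and is NOT proved here; the gate records a `conditional-result`; PARTITION 0;
BSD is proved for no class.
[cite: Miller2011LMS, Def. 1.1 (arXiv:1010.2431 p. 3)] [cite: Wuthrich2014, Prop. 21 (p. 400)] [cite: Wan2015, Thm. 4 (pp. 4–5)]
[cite: GreenbergLNM1716, §1 Conj. 1.11 (p. 61)] [cite: SkinnerUrban2014, Thm. 3.6.4 (p. 43)] -/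
theorem wAllCornerX11a_of_children_r12
    (h9 : thm61_splitMultiplicative ∧ thm61_nonsplitMultiplicative ∧
      (∀ (W : WeierstrassCurve ℚ) [W.IsElliptic] [W.IsGloballyMinimal] (p : ℕ) [Fact p.Prime],
        p ≠ 2 → greenberg_stevens (W := W) (p := p)) ∧
      Kato2004.thm12_4 ∧ exists_isNewformOf ∧
      Kato2004.exists_multDivisibilityInputs_nonsplit_contra ∧
      Kato2004.exists_multDivisibilityInputs_split_contra ∧
      Kato2004.exists_multDivisibilityInputs_fine_contra ∧ mazur_not_dvd_maninConstant_of_odd)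
    (h11 : thm311_cotorsion_weightK_member_ofLevel_odd ∧ thm1_muAlg_of_weightK_member_ofLevel_odd ∧
      Wan2015.thm4_rational_weightK_member_of_bdd_ofLevel_irred ∧
      thm513_transfer_from_weightK_member_of_bdd_ofLevel_odd ∧
      DeligneSerre1974.thm61_exists_adicGaloisRep ∧ Hida2000_thm326_ordinary ∧
      kato_charIdeal_dvd_multiplicative_of_surjective ∧
      rank_eq_analyticRank_of_analyticRank_le_one ∧
      thm12_not_le_normalizer_splitCartan ∧
      ribet1990_levelLowering_gamma0_newform_at_three_additiveDrop ∧
      carayolLivne_additivePrime_dvd_level_of_congruent_newform)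
    (hR : thm364_rational_weightK_member_of_bdd_ofLevel_ram)
    (hQ4 : cor514_transfer_of_goodOrdinary_odd ∧ YanZhu2026.thm49_charIdeal_eq_padicLFunction ∧
      thm1_muAlg_transfer_goodOrdinary_of_mult_odd ∧ thm1_muAn_transfer_goodOrdinary_of_mult_odd)
    (h48 : Summit.BirchSwinnertonDyer.BirchSwinnertonDyer.Theses.ErratumRoadFive.NonSurjCornerTwinMuAn)
    (hS : ∀ (W : WeierstrassCurve ℚ) [W.IsElliptic] [W.IsGloballyMinimal] (p : ℕ) [Fact p.Prime],
      ClassX11a W p → 5 ≤ p → Surj W p → ¬ X11a.ShaAnUnit W p → X11a.MuAnZeroAt W p)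
    (hM : ∀ (W : WeierstrassCurve ℚ) [W.IsElliptic] [W.IsGloballyMinimal] (p : ℕ) [Fact p.Prime],
      ClassX11a W p → p = 3 → ¬ X11a.ShaAnUnit W p →
      ¬ (Surj W p ∧ ∃ v : HeightOneSpectrum ℤ, W.HasAdditiveReductionAt v ∧
          3 ∣ (W.kodairaSymbolAt v).componentGroupOrder ∧ ¬ natGenerator v ^ 3 ∣ W.conductorNorm ℤ) →
      ¬ p ∣ padicValInt p W.minimalDiscriminantInt → MemberRatEqAt W p)
    (hWu : Wuthrich2014.sha_dvd_analyticSha) :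
    Summit.BirchSwinnertonDyer.WAllCornerX11a :=
  wAllCornerX11a_of_children_r11 h9 h11 hR hQ4 h48 hS
    (Birth.lowerTresRamifieThree_of_memberRatEqAt_of_nineFactsOddGS_of_elevenFacts h9 h11 hM) hWu

end Summit.BirchSwinnertonDyer.BirchSwinnertonDyer.Theorems.PrintX11aLeaf

end
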